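import Mathlib
import Summits.CriticalPhenomena.CardyFormulaZ2.Theorems.CardyMagicRigidityDefs
import Summits.CriticalPhenomena.CardyFormulaZ2.Theorems.CardyMagicRigidityPositiveConeDefs
import Summits.CriticalPhenomena.CardyFormulaZ2.Theorems.CardyMagicRigidityNestingRigidityTowerPressureSanity
import HarnessLib

/-!
# Crux `NestingRigidity`, line `ring-cloud-tomography` (r3), stub R3 `stub_pressureCalibration`

Crux `Summit.CriticalPhenomena.CardyFormulaZ2.Theses.CardyMagicRigidity.NestingRigidity`
(stmt-CriticalPhenomena-4835), line `ring-cloud-tomography`, skeleton r3.  Stub R3 is the pure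
real-analysis CALIBRATION step of the `n = 1` layer: for a lattice loop ensemble `E`, the cone sandwich
`ConeTiltLaw E` (charges `t ∈ (−π/6, π/6)`) together with the same sandwich at the PARTNER charges
`t' ∈ (−5π/6, −π/2)` force

* (a) the nesting density `NestingDensity E`: the partner charge `t' = −2π/3` has tower weight
  `w(−2π/3) = 2cos(−π/3) = 1`, so the sandwich reads `r^{1/3 ± η'} ≷ exp(−(2π/√3) E_δ[N_0(r,1)])`, i.e.
  `E_δ[N_0(r,1)] = (ν ± η) log(1/r)` with `ν = √3/(2π) · 1/3 = 1/(2π√3) = nuSix`;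
* (b) the Schramm–Sheffield–Wilson pressure `E.HasTowerPressure e6 (Ioo 0 √3)`: a weight
  `u ∈ (0, √3)` is `w(t) = w(t')` for `t = arccos(u/2) − π/3 ∈ (−π/6, π/6)` and `t' = −t − 2π/3`
  (`magicWeight_doubling`); the two sandwiches are four linear inequalities in `log E_δ[u^N]` and the
  drift `√3 E_δ[N]`, and eliminating the drift (an LP step with multipliers `−t' > 0` and `t`) leaves
  `log E_δ[u^N] = (βt² + t/(2π) ± ε) log ρ`, where `βt² + t/(2π) = e6 u` (`β = 3/(4π²)`).

Only Mathlib real analysis and the landed vocabulary (`CardyMagicRigidityDefs`,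
`CardyMagicRigidityPositiveConeDefs`, `…TowerPressureSanity`) are used.
-/

noncomputable section

open MeasureTheory Set Filter Metric
open scoped Real Topology

namespace Summit.CriticalPhenomena.CardyFormulaZ2.Cruxes.NestingRigidity.RingCloudTomography

open Summit.CriticalPhenomena.CardyFormulaZ2.Cruxes.NestingRigidity.PositiveConeWeightDoubling
  (magicWeight beta nuSix meanTower ConeTiltLaw NestingDensity magicWeight_doubling exponent_gap
    density_from_doubling sqrt_three_mul_nuSix)

/-! ## Elementary real analysis -/

/-- A two-sided `rpow` sandwich `r ^ x ≤ V ≤ r ^ y` (`r, V > 0`) in logarithms. -/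
private theorem log_sandwich {r x y V : ℝ} (hr : 0 < r) (hV : 0 < V) (h₁ : r ^ x ≤ V)
    (h₂ : V ≤ r ^ y) : x * Real.log r ≤ Real.log V ∧ Real.log V ≤ y * Real.log r := by
  refine ⟨?_, ?_⟩
  · have h := Real.log_le_log (Real.rpow_pos_of_pos hr x) h₁
    rwa [Real.log_rpow hr] at h
  · have h := Real.log_le_log hV h₂
    rwa [Real.log_rpow hr] at h

/-- Back from logarithms: `x * log ρ ≤ log M` gives `ρ ^ x ≤ M`, and `log M ≤ y * log ρ` gives
`M ≤ ρ ^ y` (`ρ, M > 0`). -/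
private theorem rpow_sandwich {ρ x y M : ℝ} (hρ : 0 < ρ) (hM : 0 < M) (h₁ : x * Real.log ρ ≤ Real.log M)
    (h₂ : Real.log M ≤ y * Real.log ρ) : ρ ^ x ≤ M ∧ M ≤ ρ ^ y := by
  rw [Real.rpow_def_of_pos hρ, Real.rpow_def_of_pos hρ]
  refine ⟨?_, ?_⟩
  · calc Real.exp (Real.log ρ * x) ≤ Real.exp (Real.log M) := Real.exp_le_exp.2 (by linarith)
      _ = M := Real.exp_log hM
  · calc M = Real.exp (Real.log M) := (Real.exp_log hM).symm
      _ ≤ Real.exp (Real.log ρ * y) := Real.exp_le_exp.2 (by linarith)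

/-- **The LP step.** Four linear inequalities `(X ± η)ℓ ≶ P`, `(Y ± η)ℓ ≶ Q` (`ℓ < 0`) in two readings
`P, Q` of the same quantity `a` (`(λ + μ) a = λ P + μ Q`, multipliers `λ ≥ μ > −λ`) pin `a` to
`(Z ± ε)ℓ`, where `(λ + μ) Z = λ X + μ Y`, as soon as `2λη ≤ (λ + μ)ε`. -/
private theorem calibration_lp {a P Q ℓ lam mu X Y Z η ε : ℝ} (hℓ : ℓ < 0) (hlam : 0 ≤ lam)
    (hd : 0 < lam + mu) (hmu : mu ≤ lam) (hη : 0 ≤ η)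
    (hb : 2 * lam * η ≤ (lam + mu) * ε) (ha : (lam + mu) * a = lam * P + mu * Q)
    (hZ : lam * X + mu * Y = (lam + mu) * Z) (hP₁ : (X + η) * ℓ ≤ P) (hP₂ : P ≤ (X - η) * ℓ)
    (hQ₁ : (Y + η) * ℓ ≤ Q) (hQ₂ : Q ≤ (Y - η) * ℓ) : (Z + ε) * ℓ ≤ a ∧ a ≤ (Z - ε) * ℓ := by
  have hZℓ : (lam * X + mu * Y) * ℓ = (lam + mu) * Z * ℓ := by rw [hZ]
  have hbℓ : (lam + mu) * ε * ℓ ≤ 2 * lam * η * ℓ := mul_le_mul_of_nonpos_right hb hℓ.le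
  have hP₁' := mul_le_mul_of_nonneg_left hP₁ hlam
  have hP₂' := mul_le_mul_of_nonneg_left hP₂ hlam
  have hs₁ : (lam - mu) * η * ℓ ≤ 0 :=
    mul_nonpos_of_nonneg_of_nonpos (mul_nonneg (sub_nonneg.2 hmu) hη) hℓ.le
  have hs₂ : (lam + mu) * η * ℓ ≤ 0 := mul_nonpos_of_nonneg_of_nonpos (mul_nonneg hd.le hη) hℓ.le
  refine ⟨le_of_mul_le_mul_left ?_ hd, le_of_mul_le_mul_left ?_ hd⟩
  · rcases le_total 0 mu with hmu0 | hmu0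
    · have hQ := mul_le_mul_of_nonneg_left hQ₁ hmu0
      linarith
    · have hQ := mul_le_mul_of_nonpos_left hQ₂ hmu0
      linarith
  · rcases le_total 0 mu with hmu0 | hmu0
    · have hQ := mul_le_mul_of_nonneg_left hQ₂ hmu0
      linarith
    · have hQ := mul_le_mul_of_nonpos_left hQ₁ hmu0
      linarith

/-! ## The lever's constants at the special charges -/

/-- The partner charge `−2π/3` has the trivial tower weight: `w(−2π/3) = 2cos(−π/3) = 1`. -/
private theorem magicWeight_partner_zero : magicWeight (-(2 * π / 3)) = 1 := by
  unfold magicWeight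
  rw [show -(2 * π / 3) + π / 3 = -(π / 3) by ring, Real.cos_neg, Real.cos_pi_div_three]
  norm_num

/-- … and Gaussian exponent `β (2π/3)² = 1/3`. -/
private theorem beta_partner_zero : beta * (-(2 * π / 3)) ^ 2 = 1 / 3 := by
  unfold beta
  have hπ : π ≠ 0 := Real.pi_ne_zero
  field_simp
  ring

/-- `(2π√3/3) ν = 1/3`. -/
private theorem density_coeff : 2 * π * Real.sqrt 3 / 3 * nuSix = 1 / 3 := by
  unfold nuSix
  have hπ : π ≠ 0 := Real.pi_ne_zero
  have h3 : Real.sqrt 3 ≠ 0 := by positivity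
  field_simp

/-- Every weight `u ∈ (0, √3)` is the tower weight of a charge in the cone `(−π/6, π/6)`:
`u = w(t)`, `t = arccos(u/2) − π/3`. -/
private theorem exists_charge_of_mem {u : ℝ} (hu : u ∈ Set.Ioo 0 (Real.sqrt 3)) :
    ∃ t ∈ Set.Ioo (-(π / 6)) (π / 6), magicWeight t = u := by
  have h3 : Real.sqrt 3 < 2 := (Real.sqrt_lt' (by norm_num)).2 (by norm_num)
  have h₁ : -1 ≤ u / 2 := by linarith [hu.1]
  have h₂ : u / 2 ≤ 1 := by linarith [hu.2]
  refine ⟨Real.arccos (u / 2) - π / 3, ⟨?_, ?_⟩, ?_⟩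
  · have h := Real.arccos_lt_arccos h₁ (by linarith [hu.2] : u / 2 < Real.sqrt 3 / 2) (by linarith)
    rw [← Real.cos_pi_div_six, Real.arccos_cos (by positivity) (by linarith [Real.pi_pos])] at h
    linarith
  · have h := Real.arccos_lt_pi_div_two.2 (by linarith [hu.1] : 0 < u / 2)
    linarith
  · unfold magicWeight
    rw [sub_add_cancel, Real.cos_arccos h₁ h₂]
    ring

/-- **Calibration = SSW** in the weight variable: for a charge `t` with `t + π/3 ∈ [0, π]`,
`e6 (w t) = βt² + t/(2π)` (`arccos (cos θ) = θ`). -/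
private theorem e6_magicWeight {t : ℝ} (h₁ : 0 ≤ t + π / 3) (h₂ : t + π / 3 ≤ π) :
    e6 (magicWeight t) = beta * t ^ 2 + t / (2 * π) := by
  unfold e6 magicWeight beta
  rw [show 2 * Real.cos (t + π / 3) / 2 = Real.cos (t + π / 3) by ring, Real.arccos_cos h₁ h₂]
  have hπ : π ≠ 0 := Real.pi_ne_zero
  field_simp
  ring

/-- The exponent identity behind the LP step: with `t' = −t − 2π/3`,
`(−t') βt² + t βt'² = (t − t') (βt² + t/(2π))` (this is `β = 3/(4π²)`, cf. `exponent_gap`). -/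
private theorem lp_exponent_identity (t : ℝ) :
    (t + 2 * π / 3) * (beta * t ^ 2) + t * (beta * (-t - 2 * π / 3) ^ 2) =
      (t + 2 * π / 3 + t) * (beta * t ^ 2 + t / (2 * π)) := by
  unfold beta
  have hπ : π ≠ 0 := Real.pi_ne_zero
  field_simp
  ring

/-! ## The stub -/

/-- **R3 · PressureCalibration** (line `ring-cloud-tomography`, skeleton r3): the cone law and the
partner law of a lattice ensemble force the nesting density `ν = 1/(2π√3)` (partner charge `−2π/3`,
weight `1`) and the Schramm–Sheffield–Wilson pressure `e6` on the open weight range `(0, √3)` (two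
readings of `E[w^N]` at the equal-weight pair `(t, −t − 2π/3)`; `βt² + t/2π = e6 (w t)`). -/
theorem stub_pressureCalibration : ∀ E ∈ latticeEnsembles, ConeTiltLaw E →
    (∀ t ∈ Set.Ioo (-(5 * π / 6)) (-(π / 2)), ∀ η : ℝ, 0 < η → ∃ r₀ : ℝ, 0 < r₀ ∧ ∀ r ∈ Set.Ioo (0 : ℝ) r₀,
      ∀ᶠ δ in 𝓝[>] (0 : ℝ),
        r ^ (beta * t ^ 2 + η) ≤
            E.towerMoment (magicWeight t) δ r * Real.exp (Real.sqrt 3 * t * meanTower E δ r) ∧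
          E.towerMoment (magicWeight t) δ r * Real.exp (Real.sqrt 3 * t * meanTower E δ r) ≤
            r ^ (beta * t ^ 2 - η)) →
    NestingDensity E ∧ E.HasTowerPressure e6 (Set.Ioo 0 (Real.sqrt 3)) := by
  intro E hE hcone hpartner
  haveI := isProbabilityMeasure_of_mem hE
  refine ⟨fun η hη ↦ ?_, fun u hu ε hε ↦ ?_⟩
  · /- (a) the density, from the partner sandwich at `t' = −2π/3` (weight `1`) -/
    have hmem : -(2 * π / 3) ∈ Set.Ioo (-(5 * π / 6)) (-(π / 2)) := by
      constructor <;> linarith [Real.pi_pos]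
    have hk : (0 : ℝ) < 2 * π * Real.sqrt 3 / 3 := by positivity
    obtain ⟨r₀, hr₀, H⟩ := hpartner _ hmem (2 * π * Real.sqrt 3 / 3 * η) (mul_pos hk hη)
    refine ⟨r₀, hr₀, fun r hr ↦ ?_⟩
    filter_upwards [H r hr] with δ hδ
    rw [magicWeight_partner_zero, towerMoment_one, one_mul, beta_partner_zero] at hδ
    obtain ⟨h₁, h₂⟩ := log_sandwich hr.1 (Real.exp_pos _) hδ.1 hδ.2
    rw [Real.log_exp] at h₁ h₂
    have e : 2 * π * Real.sqrt 3 / 3 * nuSix * Real.log r = 1 / 3 * Real.log r := by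
      rw [density_coeff]
    rw [one_div, Real.log_inv]
    exact ⟨le_of_mul_le_mul_left (by linarith) hk, le_of_mul_le_mul_left (by linarith) hk⟩
  · /- (b) the pressure at `u = w(t) = w(t')`, `t ∈ (−π/6, π/6)`, `t' = −t − 2π/3` -/
    obtain ⟨t, ht, rfl⟩ := exists_charge_of_mem hu
    have ht' : -t - 2 * π / 3 ∈ Set.Ioo (-(5 * π / 6)) (-(π / 2)) := by
      constructor <;> linarith [ht.1, ht.2]
    have hη : 0 < ε / 3 := by positivity
    obtain ⟨r₁, hr₁, H₁⟩ := hcone t ht (ε / 3) hη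
    obtain ⟨r₂, hr₂, H₂⟩ := hpartner _ ht' (ε / 3) hη
    rw [e6_magicWeight (by linarith [ht.1, Real.pi_pos]) (by linarith [ht.2, Real.pi_pos])]
    filter_upwards [Ioo_mem_nhdsGT hr₁, Ioo_mem_nhdsGT hr₂, Ioo_mem_nhdsGT (zero_lt_one' ℝ)]
      with ρ hρ₁ hρ₂ hρ
    filter_upwards [H₁ ρ hρ₁, H₂ ρ hρ₂] with δ hA hB
    rw [magicWeight_doubling] at hB
    -- the tower moment is positive (it dominates a positive power of `ρ`)
    have hM : 0 < E.towerMoment (magicWeight t) δ ρ :=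
      (mul_pos_iff_of_pos_right (Real.exp_pos _)).1 ((Real.rpow_pos_of_pos hρ.1 _).trans_le hA.1)
    have hℓ : Real.log ρ < 0 := Real.log_neg hρ.1 hρ.2
    obtain ⟨hP₁, hP₂⟩ := log_sandwich hρ.1 (mul_pos hM (Real.exp_pos _)) hA.1 hA.2
    obtain ⟨hQ₁, hQ₂⟩ := log_sandwich hρ.1 (mul_pos hM (Real.exp_pos _)) hB.1 hB.2
    rw [Real.log_mul hM.ne' (Real.exp_pos _).ne', Real.log_exp] at hP₁ hP₂ hQ₁ hQ₂
    have hb : 2 * (t + 2 * π / 3) * (ε / 3) ≤ (t + 2 * π / 3 + t) * ε := by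
      nlinarith [mul_nonneg (show (0 : ℝ) ≤ 4 * t / 3 + 2 * π / 9 by linarith [ht.1]) hε.le]
    have ha : (t + 2 * π / 3 + t) * Real.log (E.towerMoment (magicWeight t) δ ρ) =
        (t + 2 * π / 3) * (Real.log (E.towerMoment (magicWeight t) δ ρ) +
            Real.sqrt 3 * t * meanTower E δ ρ) +
          t * (Real.log (E.towerMoment (magicWeight t) δ ρ) +
            Real.sqrt 3 * (-t - 2 * π / 3) * meanTower E δ ρ) := by
      ring
    obtain ⟨h₁, h₂⟩ := calibration_lp hℓ (by linarith [ht.1, Real.pi_pos])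
      (by linarith [ht.1, Real.pi_pos]) (by linarith [Real.pi_pos]) hη.le hb ha
      (lp_exponent_identity t) hP₁ hP₂ hQ₁ hQ₂
    exact rpow_sandwich hρ.1 hM h₁ h₂

end Summit.CriticalPhenomena.CardyFormulaZ2.Cruxes.NestingRigidity.RingCloudTomography

end
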